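import Summits.Ventures.PercRepro.S2SpreadTriangles
import Summits.Ventures.PercRepro.S2ContractionCaps

/-!
# PercRepro — S2: TWO AVOIDING CIRCUITS OF SIZE `≤ 4` FOR EVERY TRIANGLE (p7, gen 14; sub-claim S2; Lemma A′ of the spread case of `(14, 7)`)

On a spread simple core (every `≤ 9` points have nullity `≤ 3`, every rank-`2` set has `≤ 3` points, every pair has rank `2`) a
triangle `T` has, as soon as the matroid carries `≥ 7` triangles, TWO DISTINCT circuits of size `≤ 4` disjoint from it. Either
two triangles avoid `T`; or at most one does, so `≥ 5` further triangles meet `T`, at most `2` through each of its points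
(`S2.not_four_triangles_through`), hence two points `u ≠ v` of `T` carry two further triangles each. The four off-`u` points of
two triangles through `u` form a `4`-circuit `Q_u` with `u ∈ cl Q_u` (**`exists_four_circuit_of_two_triangles_through`**: the
quadruple has rank `≤ 3`, and a dependent triple inside it would put a point of one pair on the line of the other pair), and
`Q_u = Q_v` would put the seven points `T ∪ Q_u` into the plane `cl Q_u` — nullity `4` on `7` points
(**`four_circuits_ne_of_closure_mem`**). The charge of a triangle at corank `7` then drops from `C(17, 3) = 816` to
`816 − C(13, 3) = 530` (g14's `S2.top_six_inter_union_nonempty`). Axioms: standard.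
-/

open scoped Matroid

namespace PercRepro

namespace S2

open Set

variable {α : Type}

/-- Two distinct triangles through a point meet exactly in that point (no two triangles share a line). -/
theorem inter_eq_singleton_of_triangles_through (M : Matroid α) [M.Finite]
    (hC1 : ∀ L ⊆ M.E, M.eRk L = 2 → L.ncard ≤ 3)
    {A B : Set α} (hA : M.IsCircuit A) (hAc : A.ncard = 3) (hB : M.IsCircuit B) (hBc : B.ncard = 3)
    (hAB : A ≠ B) {x : α} (hxA : x ∈ A) (hxB : x ∈ B) : A ∩ B = {x} := by
  have hAfin : A.Finite := M.ground_finite.subset hA.subset_ground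
  have hBfin : B.Finite := M.ground_finite.subset hB.subset_ground
  have hu := five_le_ncard_union_of_triangles M hC1 hA hAc hB hBc hAB
  have hi := Set.ncard_union_add_ncard_inter A B hAfin hBfin
  have hle : (A ∩ B).ncard ≤ ({x} : Set α).ncard := by
    rw [Set.ncard_singleton]; omega
  exact (Set.eq_of_subset_of_ncard_le (Set.singleton_subset_iff.2 (Set.mem_inter hxA hxB)) hle
    (hAfin.subset Set.inter_subset_left)).symm

/-- The closure of a triangle minus one of its points is the triangle (no two triangles share a line). -/
theorem closure_sdiff_singleton_eq_of_triangle (M : Matroid α) [M.Finite]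
    (hC1 : ∀ L ⊆ M.E, M.eRk L = 2 → L.ncard ≤ 3)
    {B : Set α} (hB : M.IsCircuit B) (hBc : B.ncard = 3) {x : α} (hxB : x ∈ B) :
    M.closure (B \ {x}) = B := by
  have hBfin : B.Finite := M.ground_finite.subset hB.subset_ground
  have hPB : (B \ {x}).ncard = 2 := by
    have := Set.ncard_sdiff_singleton_add_one hxB hBfin
    omega
  have hsub : B ⊆ M.closure (B \ {x}) := hB.subset_closure_sdiff_singleton x
  have hrk : M.eRk (M.closure (B \ {x})) = 2 := by
    rw [M.eRk_closure_eq, (hB.sdiff_singleton_indep hxB).eRk_eq_encard,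
      ← (hBfin.subset Set.sdiff_subset).cast_ncard_eq, hPB]
    rfl
  have hle := hC1 _ (M.closure_subset_ground _) hrk
  exact (Set.eq_of_subset_of_ncard_le hsub (by rw [hBc]; exact hle)
    (M.ground_finite.subset (M.closure_subset_ground _))).symm

/-- **The quadruple of two triangles through `x` has every triple independent**: removing a point `e` of `A ∖ {x}` from
`(A ∖ {x}) ∪ (B ∖ {x})` leaves both points of `B ∖ {x}` and one point `w` of `A ∖ {x}`; a dependent triple would put `w` on
the line `cl (B ∖ {x}) = B`, so `w ∈ A ∩ B = {x}`. -/
theorem indep_union_sdiff_of_two_triangles_through (M : Matroid α) [M.Finite]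
    (hC1 : ∀ L ⊆ M.E, M.eRk L = 2 → L.ncard ≤ 3)
    (hs : ∀ e ∈ M.E, ∀ f ∈ M.E, e ≠ f → M.eRk {e, f} = 2)
    {A B : Set α} (hA : M.IsCircuit A) (hAc : A.ncard = 3) (hB : M.IsCircuit B) (hBc : B.ncard = 3)
    (hAB : A ≠ B) {x : α} (hxA : x ∈ A) (hxB : x ∈ B) {e : α} (he : e ∈ A \ {x}) :
    M.Indep (((A \ {x}) ∪ (B \ {x})) \ {e}) := by
  classical
  have hAfin : A.Finite := M.ground_finite.subset hA.subset_ground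
  have hBfin : B.Finite := M.ground_finite.subset hB.subset_ground
  have hmeet : A ∩ B = {x} := inter_eq_singleton_of_triangles_through M hC1 hA hAc hB hBc hAB hxA hxB
  have hPA : (A \ {x}).ncard = 2 := by
    have := Set.ncard_sdiff_singleton_add_one hxA hAfin
    omega
  have hPB : (B \ {x}).ncard = 2 := by
    have := Set.ncard_sdiff_singleton_add_one hxB hBfin
    omega
  have hPAfin : (A \ {x}).Finite := hAfin.subset Set.sdiff_subset
  have hPBfin : (B \ {x}).Finite := hBfin.subset Set.sdiff_subset
  have hdisj : Disjoint (A \ {x}) (B \ {x}) := by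
    rw [Set.disjoint_left]
    rintro y ⟨hyA, hyx⟩ ⟨hyB, -⟩
    exact hyx (hmeet ▸ Set.mem_inter hyA hyB)
  have hclB : M.closure (B \ {x}) = B := closure_sdiff_singleton_eq_of_triangle M hC1 hB hBc hxB
  have hSfin : (((A \ {x}) ∪ (B \ {x})) \ {e}).Finite := (hPAfin.union hPBfin).subset Set.sdiff_subset
  have hSE : ((A \ {x}) ∪ (B \ {x})) \ {e} ⊆ M.E :=
    Set.sdiff_subset.trans (Set.union_subset (Set.sdiff_subset.trans hA.subset_ground)
      (Set.sdiff_subset.trans hB.subset_ground))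
  have hS3 : (((A \ {x}) ∪ (B \ {x})) \ {e}).ncard = 3 := by
    have hU : ((A \ {x}) ∪ (B \ {x})).ncard = 4 := by
      rw [Set.ncard_union_eq hdisj hPAfin hPBfin, hPA, hPB]
    have := Set.ncard_sdiff_singleton_add_one (Set.mem_union_left _ he) (hPAfin.union hPBfin)
    omega
  by_contra hnot
  have hdep : M.Dep (((A \ {x}) ∪ (B \ {x})) \ {e}) := (M.not_indep_iff hSE).1 hnot
  -- the two points of `B ∖ {x}` lie in the triple
  obtain ⟨c, d, hcd, hBcd⟩ := Set.ncard_eq_two.1 hPB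
  have hcB : c ∈ B \ {x} := by rw [hBcd]; exact Set.mem_insert c {d}
  have hdB : d ∈ B \ {x} := by rw [hBcd]; exact Set.mem_insert_of_mem c (Set.mem_singleton d)
  have hcS : c ∈ ((A \ {x}) ∪ (B \ {x})) \ {e} :=
    ⟨Set.mem_union_right _ hcB, fun h => hdisj.ne_of_mem he hcB (Set.mem_singleton_iff.1 h).symm⟩
  have hdS : d ∈ ((A \ {x}) ∪ (B \ {x})) \ {e} :=
    ⟨Set.mem_union_right _ hdB, fun h => hdisj.ne_of_mem he hdB (Set.mem_singleton_iff.1 h).symm⟩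
  have hsub := subset_closure_pair_of_dep_three M hs hSE hS3 hdep hcS hdS hcd
  rw [← hBcd, hclB] at hsub
  -- the other point `w` of `A ∖ {x}`
  have hw1 : ((A \ {x}) \ {e}).ncard = 1 := by
    have := Set.ncard_sdiff_singleton_add_one he hPAfin
    omega
  obtain ⟨w, hw⟩ := Set.ncard_eq_one.1 hw1
  have hwm : w ∈ (A \ {x}) \ {e} := by rw [hw]; exact Set.mem_singleton w
  have hwS : w ∈ ((A \ {x}) ∪ (B \ {x})) \ {e} := ⟨Set.mem_union_left _ hwm.1, hwm.2⟩
  have hwB : w ∈ B := hsub hwS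
  have hwx : w ∈ A ∩ B := Set.mem_inter hwm.1.1 hwB
  rw [hmeet] at hwx
  exact hwm.1.2 hwx

/-- **The four off-`x` points of two distinct triangles through `x` form a `4`-circuit** disjoint from a third triangle
`T ∋ x` (both triangles `≠ T`), and `x` lies in its closure. -/
theorem exists_four_circuit_of_two_triangles_through (M : Matroid α) [M.Finite]
    (hC1 : ∀ L ⊆ M.E, M.eRk L = 2 → L.ncard ≤ 3)
    (hs : ∀ e ∈ M.E, ∀ f ∈ M.E, e ≠ f → M.eRk {e, f} = 2)
    {T T' T'' : Set α} (hT : M.IsCircuit T) (hT3 : T.ncard = 3)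
    (hT' : M.IsCircuit T') (hT'3 : T'.ncard = 3) (hT'' : M.IsCircuit T'') (hT''3 : T''.ncard = 3)
    (hne' : T' ≠ T) (hne'' : T'' ≠ T) (hne : T' ≠ T'') {x : α} (hx : x ∈ T) (hx' : x ∈ T') (hx'' : x ∈ T'') :
    ∃ Q : Set α, M.IsCircuit Q ∧ Q.ncard = 4 ∧ Disjoint Q T ∧ x ∈ M.closure Q := by
  classical
  have hfin : ∀ {C : Set α}, M.IsCircuit C → C.Finite := fun hC => M.ground_finite.subset hC.subset_ground
  have hrk : ∀ {C : Set α}, M.IsCircuit C → C.ncard = 3 → M.eRk C ≤ 2 := by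
    intro C hC hCc
    have h := hC.eRk_add_one_eq
    rw [← (hfin hC).cast_ncard_eq, hCc] at h
    have h' : M.eRk C + 1 ≤ 2 + 1 := by rw [h]; norm_num
    exact (ENat.add_le_add_iff_right (by simp)).1 h'
  have hxn : M.IsNonloop x := hT'.isNonloop_of_mem_of_one_lt_card (by
    rw [← (hfin hT').cast_ncard_eq, hT'3]; norm_num) hx'
  have hdisj : ∀ {A B : Set α}, A ∩ B = {x} → Disjoint (A \ {x}) B := by
    intro A B h
    rw [Set.disjoint_left]
    rintro y ⟨hyA, hyx⟩ hyB
    exact hyx (h ▸ Set.mem_inter hyA hyB)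
  have hP'fin : (T' \ {x}).Finite := (hfin hT').subset Set.sdiff_subset
  have hP''fin : (T'' \ {x}).Finite := (hfin hT'').subset Set.sdiff_subset
  have hP'2 : (T' \ {x}).ncard = 2 := by
    have := Set.ncard_sdiff_singleton_add_one hx' (hfin hT')
    omega
  have hP''2 : (T'' \ {x}).ncard = 2 := by
    have := Set.ncard_sdiff_singleton_add_one hx'' (hfin hT'')
    omega
  have hPP : Disjoint (T' \ {x}) (T'' \ {x}) :=
    (hdisj (inter_eq_singleton_of_triangles_through M hC1 hT' hT'3 hT'' hT''3 hne hx' hx'')).mono_right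
      Set.sdiff_subset
  refine ⟨(T' \ {x}) ∪ (T'' \ {x}), ?_, ?_, ?_, ?_⟩
  · -- dependent, every triple independent
    have hQE : (T' \ {x}) ∪ (T'' \ {x}) ⊆ M.E :=
      Set.union_subset (Set.sdiff_subset.trans hT'.subset_ground) (Set.sdiff_subset.trans hT''.subset_ground)
    have hQ4 : ((T' \ {x}) ∪ (T'' \ {x})).ncard = 4 := by
      rw [Set.ncard_union_eq hPP hP'fin hP''fin, hP'2, hP''2]
    have hQrk : M.eRk ((T' \ {x}) ∪ (T'' \ {x})) ≤ 3 := by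
      have h1 := eRk_union_le_add_one_of_mem M hxn hx' hx'' (hrk hT'' hT''3)
      have h2 := hrk hT' hT'3
      calc M.eRk ((T' \ {x}) ∪ (T'' \ {x})) ≤ M.eRk (T' ∪ T'') :=
            M.eRk_mono (Set.union_subset_union Set.sdiff_subset Set.sdiff_subset)
        _ ≤ M.eRk T' + 1 := h1
        _ ≤ 2 + 1 := by gcongr
        _ = 3 := by norm_num
    have hQdep : M.Dep ((T' \ {x}) ∪ (T'' \ {x})) := by
      rw [← M.not_indep_iff hQE]
      intro hI
      have h := hI.eRk_eq_encard
      rw [← (hP'fin.union hP''fin).cast_ncard_eq, hQ4] at h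
      rw [h] at hQrk
      norm_num at hQrk
    refine Matroid.isCircuit_iff_dep_forall_sdiff_singleton_indep.2 ⟨hQdep, fun e he => ?_⟩
    rcases he with he | he
    · exact indep_union_sdiff_of_two_triangles_through M hC1 hs hT' hT'3 hT'' hT''3 hne hx' hx'' he
    · rw [Set.union_comm]
      exact indep_union_sdiff_of_two_triangles_through M hC1 hs hT'' hT''3 hT' hT'3 hne.symm hx'' hx' he
  · rw [Set.ncard_union_eq hPP hP'fin hP''fin, hP'2, hP''2]
  · exact Set.disjoint_union_left.2
      ⟨hdisj (inter_eq_singleton_of_triangles_through M hC1 hT' hT'3 hT hT3 hne' hx' hx),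
        hdisj (inter_eq_singleton_of_triangles_through M hC1 hT'' hT''3 hT hT3 hne'' hx'' hx)⟩
  · exact M.closure_mono Set.subset_union_left (hT'.mem_closure_sdiff_singleton_of_mem hx')

/-- **Two `4`-circuits avoiding a triangle `T` whose closures contain two distinct points of `T` are distinct**: otherwise
the seven points `T ∪ Q` lie in the plane `cl Q` — nullity `4` on `7` points, excluded on a spread core. -/
theorem four_circuits_ne_of_closure_mem (M : Matroid α) [M.Finite]
    (h9 : ∀ X ⊆ M.E, X.ncard ≤ 9 → X.encard ≤ M.eRk X + 3)
    {T : Set α} (hT : M.IsCircuit T) (hT3 : T.ncard = 3) {u v : α} (hu : u ∈ T) (hv : v ∈ T) (huv : u ≠ v)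
    {Qu Qv : Set α} (hQu : M.IsCircuit Qu) (hQu4 : Qu.ncard = 4) (hQuT : Disjoint Qu T) (huQ : u ∈ M.closure Qu)
    (hQv : M.IsCircuit Qv) (hvQ : v ∈ M.closure Qv) : Qu ≠ Qv := by
  intro heq
  subst heq
  have hTfin : T.Finite := M.ground_finite.subset hT.subset_ground
  have hQfin : Qu.Finite := M.ground_finite.subset hQu.subset_ground
  -- `T ⊆ cl Qu`: the third point lies on the line `cl {u, v} ⊆ cl Qu`
  have hTcl : T ⊆ M.closure Qu := by
    have hline : M.closure {u, v} ⊆ M.closure Qu :=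
      M.closure_subset_closure_of_subset_closure (Set.insert_subset huQ (Set.singleton_subset_iff.2 hvQ))
    intro z hz
    by_cases hzu : z = u
    · exact hzu ▸ huQ
    by_cases hzv : z = v
    · exact hzv ▸ hvQ
    have hsub : T \ {z} ⊆ {u, v} := by
      obtain ⟨a, b, c, hab, hac, hbc, hTabc⟩ := Set.ncard_eq_three.1 hT3
      intro y ⟨hyT, hyz⟩
      have hyz' : y ≠ z := fun h => hyz (Set.mem_singleton_iff.2 h)
      rw [hTabc] at hyT hz hu hv
      simp only [Set.mem_insert_iff, Set.mem_singleton_iff] at hyT hz hu hv ⊢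
      rcases hyT with rfl | rfl | rfl <;> rcases hz with rfl | rfl | rfl <;>
        rcases hu with rfl | rfl | rfl <;> rcases hv with rfl | rfl | rfl <;> simp_all
    exact hline (M.closure_mono hsub (hT.mem_closure_sdiff_singleton_of_mem hz))
  have hTQ : T ∪ Qu ⊆ M.closure Qu := Set.union_subset hTcl (M.subset_closure Qu hQu.subset_ground)
  have hrkQ : M.eRk Qu ≤ 3 := by
    have h := hQu.eRk_add_one_eq
    rw [← hQfin.cast_ncard_eq, hQu4] at h
    have h' : M.eRk Qu + 1 ≤ 3 + 1 := by rw [h]; norm_num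
    exact (ENat.add_le_add_iff_right (by simp)).1 h'
  have hrk : M.eRk (T ∪ Qu) ≤ 3 := by
    calc M.eRk (T ∪ Qu) ≤ M.eRk (M.closure Qu) := M.eRk_mono hTQ
      _ = M.eRk Qu := M.eRk_closure_eq Qu
      _ ≤ 3 := hrkQ
  have hn7 : (T ∪ Qu).ncard = 7 := by
    rw [Set.ncard_union_eq hQuT.symm hTfin hQfin, hT3, hQu4]
  have hsub : T ∪ Qu ⊆ M.E := Set.union_subset hT.subset_ground hQu.subset_ground
  have h := h9 _ hsub (by omega)
  rw [← (hTfin.union hQfin).cast_ncard_eq, hn7] at h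
  have h' : (7 : ℕ∞) ≤ 3 + 3 :=
    calc (7 : ℕ∞) ≤ M.eRk (T ∪ Qu) + 3 := h
      _ ≤ 3 + 3 := by gcongr
  norm_num at h'

/-- **Two distinct circuits of size `≤ 4` avoid every triangle** once the matroid carries `≥ 7` triangles (spread simple
core): two triangles avoid `T`, or two points of `T` carry two further triangles each and their quadruples are distinct
`4`-circuits. -/
theorem exists_two_circuits_le_four_disjoint_of_seven (M : Matroid α) [M.Finite]
    (hC1 : ∀ L ⊆ M.E, M.eRk L = 2 → L.ncard ≤ 3)
    (hs : ∀ e ∈ M.E, ∀ f ∈ M.E, e ≠ f → M.eRk {e, f} = 2)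
    (h9 : ∀ X ⊆ M.E, X.ncard ≤ 9 → X.encard ≤ M.eRk X + 3)
    (h7 : 7 ≤ {C : Set α | M.IsCircuit C ∧ C.ncard = 3}.ncard)
    {T : Set α} (hT : M.IsCircuit T) (hT3 : T.ncard = 3) :
    ∃ D₁ D₂ : Set α, M.IsCircuit D₁ ∧ D₁.ncard ≤ 4 ∧ Disjoint D₁ T ∧
      M.IsCircuit D₂ ∧ D₂.ncard ≤ 4 ∧ Disjoint D₂ T ∧ D₁ ≠ D₂ := by
  classical
  set 𝒯 := {C : Set α | M.IsCircuit C ∧ C.ncard = 3} with h𝒯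
  have h𝒯fin : 𝒯.Finite := M.ground_finite.finite_subsets.subset (fun C hC => hC.1.subset_ground)
  set 𝒟 := {C : Set α | M.IsCircuit C ∧ C.ncard = 3 ∧ Disjoint C T} with h𝒟
  have h𝒟fin : 𝒟.Finite := h𝒯fin.subset (fun C hC => ⟨hC.1, hC.2.1⟩)
  by_cases h2 : 2 ≤ 𝒟.ncard
  · obtain ⟨T', T'', hT', hT'', hne⟩ := (Set.one_lt_ncard_iff h𝒟fin).1 (by omega)
    exact ⟨T', T'', hT'.1, by rw [hT'.2.1]; norm_num, hT'.2.2, hT''.1, by rw [hT''.2.1]; norm_num,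
      hT''.2.2, hne⟩
  push Not at h2
  -- the triangles through a point `u ∈ T` other than `T`: at most `2`
  have hfinS : ∀ w : α, ({T' ∈ 𝒯 | T' ≠ T ∧ w ∈ T'} : Set (Set α)).Finite :=
    fun _ => h𝒯fin.subset (fun C hC => hC.1)
  have hthrough : ∀ u ∈ T, ({T' ∈ 𝒯 | T' ≠ T ∧ u ∈ T'} : Set (Set α)).ncard ≤ 2 := by
    intro u huT
    by_contra hlt
    push Not at hlt
    obtain ⟨T₂, T₃, T₄, h2, h3, h4, h23, h24, h34⟩ := (Set.two_lt_ncard_iff (hfinS u)).1 hlt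
    exact not_four_triangles_through M hC1 h9 hT hT3 huT h2.1.1 h2.1.2 h2.2.2 h3.1.1 h3.1.2 h3.2.2
      h4.1.1 h4.1.2 h4.2.2 (Ne.symm h2.2.1) (Ne.symm h3.2.1) (Ne.symm h4.2.1) h23 h24 h34
  -- a point carrying two further triangles gives a `4`-circuit avoiding `T` with the point in its closure
  have hpair : ∀ u ∈ T, 2 ≤ ({T' ∈ 𝒯 | T' ≠ T ∧ u ∈ T'} : Set (Set α)).ncard →
      ∃ Q : Set α, M.IsCircuit Q ∧ Q.ncard = 4 ∧ Disjoint Q T ∧ u ∈ M.closure Q := by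
    intro u hu h2u
    obtain ⟨T', T'', hT', hT'', hne⟩ := (Set.one_lt_ncard_iff (hfinS u)).1 (by omega)
    exact exists_four_circuit_of_two_triangles_through M hC1 hs hT hT3 hT'.1.1 hT'.1.2 hT''.1.1 hT''.1.2
      hT'.2.1 hT''.2.1 hne hu hT'.2.2 hT''.2.2
  have hmain : ∀ u ∈ T, ∀ v ∈ T, u ≠ v → 2 ≤ ({T' ∈ 𝒯 | T' ≠ T ∧ u ∈ T'} : Set (Set α)).ncard →
      2 ≤ ({T' ∈ 𝒯 | T' ≠ T ∧ v ∈ T'} : Set (Set α)).ncard →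
      ∃ D₁ D₂ : Set α, M.IsCircuit D₁ ∧ D₁.ncard ≤ 4 ∧ Disjoint D₁ T ∧
        M.IsCircuit D₂ ∧ D₂.ncard ≤ 4 ∧ Disjoint D₂ T ∧ D₁ ≠ D₂ := by
    intro u hu v hv huv h2u h2v
    obtain ⟨Qu, hQu, hQu4, hQuT, huQ⟩ := hpair u hu h2u
    obtain ⟨Qv, hQv, hQv4, hQvT, hvQ⟩ := hpair v hv h2v
    exact ⟨Qu, Qv, hQu, hQu4.le, hQuT, hQv, hQv4.le, hQvT,
      four_circuits_ne_of_closure_mem M h9 hT hT3 hu hv huv hQu hQu4 hQuT huQ hQv hvQ⟩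
  -- the cover of the triangles by `T`, the three through-families and the avoiding ones
  obtain ⟨x, y, z, hxy, hxz, hyz, hTxyz⟩ := Set.ncard_eq_three.1 hT3
  have hxT : x ∈ T := by rw [hTxyz]; exact Set.mem_insert x _
  have hyT : y ∈ T := by rw [hTxyz]; exact Set.mem_insert_of_mem x (Set.mem_insert y _)
  have hzT : z ∈ T := by
    rw [hTxyz]; exact Set.mem_insert_of_mem x (Set.mem_insert_of_mem y (Set.mem_singleton z))
  set Sx := ({T' ∈ 𝒯 | T' ≠ T ∧ x ∈ T'} : Set (Set α)) with hSx
  set Sy := ({T' ∈ 𝒯 | T' ≠ T ∧ y ∈ T'} : Set (Set α)) with hSy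
  set Sz := ({T' ∈ 𝒯 | T' ≠ T ∧ z ∈ T'} : Set (Set α)) with hSz
  have hcover : 𝒯 ⊆ ({T} ∪ ((Sx ∪ Sy) ∪ Sz)) ∪ 𝒟 := by
    intro T' hT'
    by_cases hne : T' = T
    · exact Or.inl (Or.inl (Set.mem_singleton_iff.2 hne))
    by_cases hdis : Disjoint T' T
    · exact Or.inr ⟨hT'.1, hT'.2, hdis⟩
    · rw [Set.not_disjoint_iff] at hdis
      obtain ⟨w, hwT', hwT⟩ := hdis
      rw [hTxyz] at hwT
      simp only [Set.mem_insert_iff, Set.mem_singleton_iff] at hwT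
      rcases hwT with rfl | rfl | rfl
      · exact Or.inl (Or.inr (Or.inl (Or.inl ⟨hT', hne, hwT'⟩)))
      · exact Or.inl (Or.inr (Or.inl (Or.inr ⟨hT', hne, hwT'⟩)))
      · exact Or.inl (Or.inr (Or.inr ⟨hT', hne, hwT'⟩))
  have hle := Set.ncard_le_ncard hcover
    (((Set.finite_singleton T).union (((hfinS x).union (hfinS y)).union (hfinS z))).union h𝒟fin)
  have hu1 := Set.ncard_union_le ({T} ∪ ((Sx ∪ Sy) ∪ Sz)) 𝒟
  have hu2 := Set.ncard_union_le ({T} : Set (Set α)) ((Sx ∪ Sy) ∪ Sz)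
  have hu3 := Set.ncard_union_le (Sx ∪ Sy) Sz
  have hu4 := Set.ncard_union_le Sx Sy
  rw [Set.ncard_singleton] at hu2
  have hx2 : Sx.ncard ≤ 2 := hthrough x hxT
  have hy2 : Sy.ncard ≤ 2 := hthrough y hyT
  have hz2 : Sz.ncard ≤ 2 := hthrough z hzT
  rcases (by omega : (2 ≤ Sx.ncard ∧ 2 ≤ Sy.ncard) ∨ (2 ≤ Sx.ncard ∧ 2 ≤ Sz.ncard) ∨
      (2 ≤ Sy.ncard ∧ 2 ≤ Sz.ncard)) with ⟨ha, hb⟩ | ⟨ha, hc⟩ | ⟨hb, hc⟩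
  · exact hmain x hxT y hyT hxy ha hb
  · exact hmain x hxT z hzT hxz ha hc
  · exact hmain y hyT z hzT hyz hb hc

end S2

end PercRepro
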